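import Literature.Geometry.Lorentzian.SecondFundamentalFormApply
import Literature.Geometry.Lorentzian.CoordinateFrames
import Literature.Geometry.Lorentzian.CurvatureRegularity
import Literature.Geometry.Lorentzian.LeviCivitaProofs
import HarnessLib

/-!
# Smoothness of the second fundamental form and of the mean curvature

For a smooth pseudo-Riemannian manifold `(M, g)` (`g` of class `C^∞` with its Levi-Civita
connection), a manifold `N` (boundaryless model) and a map `f : N → M` with a field `ν` along it
(`ν y ∈ T_{f y} M`), the tree defines the second fundamental form `K_ν(v, w) = g(D_v ν, df w)`
(`PseudoRiemannianMetric.secondFundamentalForm`, `Hypersurface.lean`; `D_v ν` the covariant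
derivative of `ν` along the chart-straight curve of velocity `v`, `normalDerivAlong`) and the mean
curvature `H = tr_{f^*g} K_ν` (`meanCurvature`) POINTWISE, with no regularity statement. This file
proves the expected regularity:

* `contMDiffAt_secondFundamentalForm_apply` — for `f` of class `C^∞`, `ν` with `C^∞` lift
  `y ↦ (f y, ν y) ∈ TM` and vector fields `V, W` on `N` smooth at `y₀`, the function
  `y ↦ K_ν(V y, W y)` is `C^∞` at `y₀` (O'Neill 1983, Ch. 4, Lemma 4: the shape tensor is a
  smooth tensor field);
* `contMDiff_meanCurvature` — for a smooth spacelike immersion with such a `ν`, the mean curvature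
  `y ↦ H(y)` is `C^∞` on `N` (O'Neill 1983, Ch. 4, p. 111 ff.; Wald 1984, (10.2.13) ff.) — the
  regularity `H ∈ C²(N_t)` consumed by Green's identity in the Monotonicity Calculation
  (`IsClassicalIMCF.integral_meanCurvature_mul_dalembertian_inv_nonneg`,
  `GerochMonotonicityProofs.lean`).

The proof reads `D_v ν` in a FIXED frame `sᵢ` of `TM` (the trivialisation at `f y₀`) for all `y`
near `y₀` — `covariantDerivAlong_comp_eq_frame`, `normalDerivAlong_eq_frame`:
`D_v ν = ∑ᵢ d(sⁱ(ν))_y(v) sᵢ(f y) + ∑ᵢ sⁱ(ν y) ∇_{df v} sᵢ` (frame independence of the induced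
covariant derivative, `covariantDerivAlongFrame_eq_holds`, and the chain rules, as in
`covariantDerivAlong_comp_eq` of `SecondFundamentalFormApply.lean` which uses the frame at
`f y`) — whence `K_ν(V, W) = ∑ᵢ (V sⁱ(ν)) g(sᵢ ∘ f, df W) + ∑ᵢ sⁱ(ν) g(∇_{df V} sᵢ, df W)`
(`secondFundamentalForm_apply_eq_frame`), every term of which is smooth: the coefficients
`sⁱ(ν)` (the lift of `ν` read in the trivialisation), their derivatives along `V`
(`contMDiffAt_mvfderiv_apply_of_le`), the fields `sᵢ ∘ f`, `df W` (the tangent map of `f`) and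
`∇_{df V} sᵢ` (smooth Christoffel data, `exists_contMDiffOn_christoffel`) along `f`, paired by the
metric (`contMDiffAt_val_apply_along`, the metric being a smooth section of the bundle of bilinear
forms). The mean curvature is then `∑ (𝒢⁻¹)_{ca} K_ν(s'ₐ, s'_c)` in a frame `s'` of `TN`
(`trace_eq_sum_gram_inv`, `contMDiffOn_gram_localFrame_inv`).

Everything is proved; there are no definitions and no named facts.

## References

* B. O'Neill, *Semi-Riemannian geometry with applications to relativity*, Academic Press 1983,
  Ch. 3, Prop. 18 (induced covariant derivative on curves); Ch. 4, Lemma 1 (p. 98,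
  `D̄_V X = ∑ V(fⁱ) ∂ᵢ + ∑ fⁱ D̄_V ∂ᵢ`), Lemma 4 (p. 100, the shape tensor), p. 111 ff. (mean
  curvature) (key `ONeill1983`).
* R. M. Wald, *General Relativity*, University of Chicago Press 1984, (10.2.13) ff.
-/

noncomputable section

open Bundle Set Filter Function Manifold
open scoped Manifold ContDiff Topology

namespace Literature.Geometry.Lorentzian

variable {E : Type*} [NormedAddCommGroup E] [NormedSpace ℝ E] {H : Type*} [TopologicalSpace H]
  {I : ModelWithCorners ℝ E H} {M : Type*} [TopologicalSpace M] [ChartedSpace H M]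
  [IsManifold I ∞ M] [FiniteDimensional ℝ E]
  {E' : Type*} [NormedAddCommGroup E'] [NormedSpace ℝ E'] {H' : Type*} [TopologicalSpace H']
  {I' : ModelWithCorners ℝ E' H'} {N : Type*} [TopologicalSpace N] [ChartedSpace H' N]
  [IsManifold I' ∞ N]

/-! ### `D(ν ∘ c)/dt` and `D_v ν` in a fixed frame -/

section FixedFrame

variable (cov : CovariantDerivative I E (TangentSpace I : M → Type _))

omit [IsManifold I' ∞ N] in
/-- **The frame formula for `D(ν ∘ c)/dt` in a fixed frame.** As `covariantDerivAlong_comp_eq`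
(`SecondFundamentalFormApply.lean`), but in the frame `sᵢ` of the trivialisation of `TM` at an
arbitrary point `x₁` whose chart domain contains `f (c 0)` (coefficient functionals `sⁱ`) rather
than the canonical frame at `f (c 0)`: for a field `ν` along `f : N → M` whose lift is
differentiable at `c 0` and a curve `c` differentiable at `0`,
`D(ν ∘ c)/dt (0) = ∑ᵢ d(sⁱ(ν))_{c 0}(c' 0) sᵢ(f (c 0)) + ∑ᵢ sⁱ(ν (c 0)) ∇_{df (c' 0)} sᵢ`
(frame independence of the induced covariant derivative, `covariantDerivAlongFrame_eq_holds`,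
then the two chain rules). O'Neill 1983, Ch. 4, Lemma 1 (p. 98) with Ch. 3, Prop. 18.
[cite: ONeill1983, Ch. 4, Lemma 1] -/
theorem covariantDerivAlong_comp_eq_frame {ι : Type*} [Fintype ι] (b : Module.Basis ι ℝ E)
    (f : N → M) (ν : Π x : N, TangentSpace I (f x)) {x₁ : M} {c : ℝ → N}
    (h1 : f (c 0) ∈ (chartAt H x₁).source)
    (hν : MDifferentiableAt I' I.tangent
      (fun x ↦ (TotalSpace.mk' E (f x) (ν x) : TangentBundle I M)) (c 0))
    (hc : MDifferentiableAt 𝓘(ℝ, ℝ) I' c 0) :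
    covariantDerivAlong cov (fun t ↦ f (c t)) (fun t ↦ ν (c t)) 0 =
      ∑ i, (show ℝ from mfderiv I' 𝓘(ℝ, ℝ)
          (fun x ↦ (trivializationAt E (TangentSpace I : M → Type _) x₁).localFrame_coeff
            I b i (f x) (ν x)) (c 0) (velocity I' c 0)) •
          (trivializationAt E (TangentSpace I : M → Type _) x₁).localFrame b i (f (c 0))
      + ∑ i, (trivializationAt E (TangentSpace I : M → Type _) x₁).localFrame_coeff I b i
            (f (c 0)) (ν (c 0)) •
          cov ((trivializationAt E (TangentSpace I : M → Type _) x₁).localFrame b i) (f (c 0))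
            (mfderiv I' I f (c 0) (velocity I' c 0)) := by
  set e := trivializationAt E (TangentSpace I : M → Type _) x₁ with he_def
  have h1e : f (c 0) ∈ e.baseSet := by simpa [he_def] using h1
  -- the lift of `ν ∘ c` is differentiable at `0`
  have hlift : MDifferentiableAt 𝓘(ℝ, ℝ) I.tangent
      (fun t ↦ (TotalSpace.mk' E (f (c t)) (ν (c t)) : TangentBundle I M)) 0 := hν.comp 0 hc
  -- frame independence
  rw [← covariantDerivAlongFrame_eq_holds cov e b (γ := fun t ↦ f (c t)) (W := fun t ↦ ν (c t))
    h1e hlift]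
  -- differentiability of `f`, of the `e`-fibre coordinate of `ν` and of the coefficients `sⁱ(ν)`
  have hf : MDifferentiableAt I' I f (c 0) := ((mdifferentiableAt_totalSpace I _).1 hν).1
  have hνc : MDifferentiableAt I' 𝓘(ℝ, E)
      (fun x ↦ (e (TotalSpace.mk' E (f x) (ν x) : TangentBundle I M)).2) (c 0) := by
    have hsrc : (TotalSpace.mk' E (f (c 0)) (ν (c 0)) : TangentBundle I M) ∈ e.source := by
      rw [e.mem_source]; exact h1e
    exact ((e.mdifferentiableAt_totalSpace_iff I
      (fun x ↦ (TotalSpace.mk' E (f x) (ν x) : TangentBundle I M)) hsrc).1 hν).2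
  have hfe : ∀ᶠ x in 𝓝 (c 0), f x ∈ e.baseSet :=
    hf.continuousAt.preimage_mem_nhds (e.open_baseSet.mem_nhds h1e)
  have hφ : ∀ i, MDifferentiableAt I' 𝓘(ℝ, ℝ) (fun x ↦ e.localFrame_coeff I b i (f x) (ν x))
      (c 0) := by
    intro i
    have h1 : MDifferentiableAt I' 𝓘(ℝ, ℝ)
        (fun x ↦ b.coord i (e (TotalSpace.mk' E (f x) (ν x) : TangentBundle I M)).2) (c 0) :=
      (LinearMap.toContinuousLinearMap (b.coord i)).mdifferentiableAt.comp (c 0) hνc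
    refine h1.congr_of_eventuallyEq ?_
    filter_upwards [hfe] with x hx
    rw [e.localFrame_coeff_eq_coeff (b := b) (s := fun _ ↦ ν x) hx]
    simp
  -- chain rule for `f ∘ c`
  have hv : velocity I (fun t ↦ f (c t)) 0 = mfderiv I' I f (c 0) (velocity I' c 0) := by
    have h := mfderiv_comp 0 hf hc
    simp only [velocity]
    rw [show (fun t ↦ f (c t)) = f ∘ c from rfl, h]
    rfl
  -- the frame formula, term by term
  show ∑ i, deriv (fun t ↦ e.localFrame_coeff I b i (f (c t)) (ν (c t))) 0 •
        e.localFrame b i (f (c 0)) +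
      ∑ i, e.localFrame_coeff I b i (f (c 0)) (ν (c 0)) •
        cov (e.localFrame b i) (f (c 0)) (velocity I (fun t ↦ f (c t)) 0) = _
  rw [hv]
  congr 1
  refine Finset.sum_congr rfl fun i _ ↦ ?_
  rw [(hasDerivAt_comp_curve (hφ i) hc).deriv]

end FixedFrame

/-! ### The metric on fields along a map -/

section Along

variable {n : ℕ∞ω} (g : PseudoRiemannianMetric I n E (TangentSpace I : M → Type _))

omit [FiniteDimensional ℝ E] [IsManifold I' ∞ N] in
/-- **`g(A, B)` is `C^m` for `C^m` fields `A, B` along a map** (with the same base map): the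
metric is a `C^n` section of the bundle of bilinear forms, `m ≤ n` (Mathlib's
`ContMDiffAt.clm_bundle_apply₂` along a base map; compare `contMDiffAt_val_apply` of
`CurvatureSymmetries.lean` for vector fields and Mathlib's `ContMDiffAt.inner_bundle`).
[folklore] -/
theorem contMDiffAt_val_apply_along {m : ℕ∞ω} (hm : m ≤ n) {f : N → M}
    {A B : Π y : N, TangentSpace I (f y)} {y : N}
    (hA : ContMDiffAt I' I.tangent m (fun y ↦ (TotalSpace.mk' E (f y) (A y) : TangentBundle I M)) y)
    (hB : ContMDiffAt I' I.tangent m (fun y ↦ (TotalSpace.mk' E (f y) (B y) : TangentBundle I M)) y) :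
    ContMDiffAt I' 𝓘(ℝ, ℝ) m (fun y ↦ g.val (f y) (A y) (B y)) y := by
  have hf : ContMDiffAt I' I m f y := (contMDiffAt_totalSpace.1 hA).1
  have hg : ContMDiffAt I' (I.prod 𝓘(ℝ, E →L[ℝ] E →L[ℝ] ℝ)) m
      (fun y ↦ TotalSpace.mk' (E →L[ℝ] E →L[ℝ] ℝ)
        (E := fun x : M ↦ TangentSpace I x →L[ℝ] TangentSpace I x →L[ℝ] ℝ) (f y) (g.val (f y))) y := by
    exact ((g.contMDiff (f y)).of_le hm).comp y hf
  have : ContMDiffAt I' (I.prod 𝓘(ℝ, ℝ)) m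
      (fun y ↦ TotalSpace.mk' ℝ (E := Bundle.Trivial M ℝ) (f y) (g.val (f y) (A y) (B y))) y := by
    apply ContMDiffAt.clm_bundle_apply₂ (F₁ := E) (F₂ := E)
    · exact hg
    · exact hA
    · exact hB
  simp only [contMDiffAt_totalSpace] at this
  exact this.2

end Along

/-! ### `D_v ν` in a fixed frame and the smoothness of the second fundamental form -/

namespace PseudoRiemannianMetric

variable (g : PseudoRiemannianMetric I ∞ E (TangentSpace I : M → Type _)) [g.HasLeviCivita]

/-- **`D_v ν` in a fixed frame.** For an interior point `y` of `N` with `f y` in the chart domain of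
`x₁`, a field `ν` along `f` whose lift is differentiable at `y`, and `v ∈ T_y N`:
`D_v ν = ∑ᵢ d(sⁱ(ν))_y(v) sᵢ(f y) + ∑ᵢ sⁱ(ν y) ∇_{df_y v} sᵢ` in the frame `sᵢ` of the
trivialisation of `TM` at `x₁` (`covariantDerivAlong_comp_eq_frame` for the chart-straight curve
of velocity `v`). O'Neill 1983, Ch. 4, Lemma 1 (p. 98). [cite: ONeill1983, Ch. 4, Lemma 1] -/
theorem normalDerivAlong_eq_frame {ι : Type*} [Fintype ι] (b : Module.Basis ι ℝ E) {f : N → M}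
    {ν : NormalField I f} {x₁ : M} {y : N} (h1 : f y ∈ (chartAt H x₁).source)
    (hy : I'.IsInteriorPoint y)
    (hν : MDifferentiableAt I' I.tangent
      (fun x ↦ (TotalSpace.mk' E (f x) (ν x) : TangentBundle I M)) y)
    (v : TangentSpace I' y) :
    g.normalDerivAlong f ν y v =
      ∑ i, (show ℝ from mfderiv I' 𝓘(ℝ, ℝ)
          (fun x ↦ (trivializationAt E (TangentSpace I : M → Type _) x₁).localFrame_coeff
            I b i (f x) (ν x)) y v) •
          (trivializationAt E (TangentSpace I : M → Type _) x₁).localFrame b i (f y)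
      + ∑ i, (trivializationAt E (TangentSpace I : M → Type _) x₁).localFrame_coeff I b i
            (f y) (ν y) •
          g.leviCivita ((trivializationAt E (TangentSpace I : M → Type _) x₁).localFrame b i) (f y)
            (mfderiv I' I f y v) := by
  have hν' : MDifferentiableAt I' I.tangent
      (fun x ↦ (TotalSpace.mk' E (f x) (ν x) : TangentBundle I M)) (curveThrough I' y v 0) := by
    rw [curveThrough_zero]; exact hν
  have h1' : f (curveThrough I' y v 0) ∈ (chartAt H x₁).source := by
    rw [curveThrough_zero]; exact h1
  have h := covariantDerivAlong_comp_eq_frame g.leviCivita b f ν h1' hν'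
    (mdifferentiableAt_curveThrough_zero hy v)
  rw [curveThrough_zero, velocity_curveThrough_zero_holds hy v] at h
  exact h

variable [FiniteDimensional ℝ E'] [I'.Boundaryless] [CompleteSpace E]

omit [CompleteSpace E] in
/-- **The second fundamental form on vector fields, in a fixed frame.** For `f : N → M` and a field
`ν` along `f` with differentiable lift, vector fields `V, W` on `N` and a point `y` with `f y` in
the chart domain of `x₁`:
`K_ν(V y, W y) = ∑ᵢ (V sⁱ(ν))(y) g(sᵢ(f y), df W) + ∑ᵢ sⁱ(ν y) g(∇_{df V} sᵢ, df W)`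
(`secondFundamentalForm_apply_holds` and `normalDerivAlong_eq_frame`). O'Neill 1983, Ch. 4,
Lemma 1 and Lemma 4. [cite: ONeill1983, Ch. 4, Lemma 1 and Lemma 4] -/
theorem secondFundamentalForm_apply_eq_frame {ι : Type*} [Fintype ι] (b : Module.Basis ι ℝ E)
    {f : N → M} {ν : NormalField I f} {x₁ : M} {y : N} (h1 : f y ∈ (chartAt H x₁).source)
    (hν : MDifferentiableAt I' I.tangent
      (fun x ↦ (TotalSpace.mk' E (f x) (ν x) : TangentBundle I M)) y)
    (V W : Π y : N, TangentSpace I' y) :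
    g.secondFundamentalForm I' f ν y (V y) (W y) =
      ∑ i, (show ℝ from mfderiv I' 𝓘(ℝ, ℝ)
          (fun x ↦ (trivializationAt E (TangentSpace I : M → Type _) x₁).localFrame_coeff
            I b i (f x) (ν x)) y (V y)) *
          g.val (f y) ((trivializationAt E (TangentSpace I : M → Type _) x₁).localFrame b i (f y))
            (mfderiv I' I f y (W y))
      + ∑ i, (trivializationAt E (TangentSpace I : M → Type _) x₁).localFrame_coeff I b i
            (f y) (ν y) *
          g.val (f y) (g.leviCivita ((trivializationAt E (TangentSpace I : M → Type _) x₁).localFrame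
            b i) (f y) (mfderiv I' I f y (V y))) (mfderiv I' I f y (W y)) := by
  rw [secondFundamentalForm_apply_holds BoundarylessManifold.isInteriorPoint hν (V y) (W y),
    g.normalDerivAlong_eq_frame b h1 BoundarylessManifold.isInteriorPoint hν (V y)]
  simp only [map_add, map_sum, map_smul, _root_.add_apply, FunLike.coe_sum,
    Finset.sum_apply, FunLike.coe_smul, Pi.smul_apply, smul_eq_mul]

/-- **The second fundamental form of a smooth hypersurface with smooth normal field is smooth**:
for `f : N → M` of class `C^∞`, a field `ν` along `f` with `C^∞` lift `y ↦ (f y, ν y) ∈ TM`, and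
vector fields `V, W` on `N` of class `C^∞` at `y₀`, the function `y ↦ K_ν(V y, W y)` is `C^∞` at
`y₀` — read in the frame of `TM` at `f y₀` (`secondFundamentalForm_apply_eq_frame`), every term is
smooth: the coefficients `sⁱ(ν)` and their derivatives `V sⁱ(ν)` (`contMDiffAt_mvfderiv_apply_of_le`),
the fields `sᵢ ∘ f`, `df W` (the tangent map) and `∇_{df V} sᵢ` (smooth Christoffel data,
`exists_contMDiffOn_christoffel`) along `f`, paired by the metric (`contMDiffAt_val_apply_along`).
O'Neill 1983, Ch. 4, Lemma 4 (the shape tensor is a smooth tensor field). [cite: ONeill1983, Ch. 4, Lemma 4] -/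
theorem contMDiffAt_secondFundamentalForm_apply {f : N → M} {ν : NormalField I f}
    (hf : ContMDiff I' I ∞ f)
    (hν : ContMDiff I' I.tangent ∞ (fun x ↦ (TotalSpace.mk' E (f x) (ν x) : TangentBundle I M)))
    {V W : Π y : N, TangentSpace I' y} {y₀ : N} (hV : CMDiffAt ∞ (T% V) y₀)
    (hW : CMDiffAt ∞ (T% W) y₀) :
    CMDiffAt ∞ (fun y ↦ g.secondFundamentalForm I' f ν y (V y) (W y)) y₀ := by
  classical
  set x₁ := f y₀ with hx₁
  set e := trivializationAt E (TangentSpace I : M → Type _) x₁ with he_def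
  set b := Module.finBasis ℝ E with hb_def
  have hbase : e.baseSet = (chartAt H x₁).source := by simp [he_def]
  have h1₀ : f y₀ ∈ (chartAt H x₁).source := mem_chart_source H x₁
  -- the formula holds near `y₀`
  have hnear : ∀ᶠ y in 𝓝 y₀, f y ∈ (chartAt H x₁).source :=
    (hf y₀).continuousAt.preimage_mem_nhds ((chartAt H x₁).open_source.mem_nhds h1₀)
  have hformula : (fun y ↦ g.secondFundamentalForm I' f ν y (V y) (W y)) =ᶠ[𝓝 y₀] fun y ↦
      ∑ i, (show ℝ from mfderiv I' 𝓘(ℝ, ℝ) (fun x ↦ e.localFrame_coeff I b i (f x) (ν x)) y (V y)) *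
          g.val (f y) (e.localFrame b i (f y)) (mfderiv I' I f y (W y))
      + ∑ i, e.localFrame_coeff I b i (f y) (ν y) *
          g.val (f y) (g.leviCivita (e.localFrame b i) (f y) (mfderiv I' I f y (V y)))
            (mfderiv I' I f y (W y)) := by
    filter_upwards [hnear] with y hy
    exact g.secondFundamentalForm_apply_eq_frame b hy ((hν y).mdifferentiableAt (by simp)) V W
  refine ContMDiffAt.congr_of_eventuallyEq ?_ hformula
  -- smoothness of the ingredients at `y₀`
  -- (i) the coefficient functions `sⁱ(ν)`
  have hsrc : (TotalSpace.mk' E (f y₀) (ν y₀) : TangentBundle I M) ∈ e.source := by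
    rw [e.mem_source, hbase]; exact h1₀
  have hνc : ContMDiffAt I' 𝓘(ℝ, E) ∞
      (fun x ↦ (e (TotalSpace.mk' E (f x) (ν x) : TangentBundle I M)).2) y₀ :=
    ((e.contMDiffAt_iff (f := fun x ↦ (TotalSpace.mk' E (f x) (ν x) : TangentBundle I M))
      hsrc).1 (hν y₀)).2
  have hφ : ∀ i, CMDiffAt ∞ (fun x ↦ e.localFrame_coeff I b i (f x) (ν x)) y₀ := by
    intro i
    have h1 : CMDiffAt ∞
        (fun x ↦ b.coord i (e (TotalSpace.mk' E (f x) (ν x) : TangentBundle I M)).2) y₀ :=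
      (LinearMap.toContinuousLinearMap (b.coord i)).contMDiff.contMDiffAt.comp y₀ hνc
    refine h1.congr_of_eventuallyEq ?_
    filter_upwards [hnear] with x hx
    have hxe : f x ∈ e.baseSet := by rwa [hbase]
    rw [e.localFrame_coeff_eq_coeff (b := b) (s := fun _ ↦ ν x) hxe]
    simp
  -- (ii) their derivatives along `V`
  have hVφ : ∀ i, CMDiffAt ∞ (fun y ↦ (show ℝ from mfderiv I' 𝓘(ℝ, ℝ)
      (fun x ↦ e.localFrame_coeff I b i (f x) (ν x)) y (V y))) y₀ := fun i ↦
    contMDiffAt_mvfderiv_apply_of_le (m := ∞) ((hφ i).of_le le_rfl) hV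
  -- (iii) the fields `sᵢ ∘ f`, `df V`, `df W` along `f`
  have hsf : ∀ i, ContMDiffAt I' I.tangent ∞
      (fun y ↦ (TotalSpace.mk' E (f y) (e.localFrame b i (f y)) : TangentBundle I M)) y₀ := fun i ↦
    (contMDiffAt_localFrame_of_mem ∞ e b i (by rw [hbase]; exact h1₀)).comp y₀ (hf y₀)
  have htan : ∀ {X : Π y : N, TangentSpace I' y}, CMDiffAt ∞ (T% X) y₀ →
      ContMDiffAt I' I.tangent ∞
        (fun y ↦ (TotalSpace.mk' E (f y) (mfderiv I' I f y (X y)) : TangentBundle I M)) y₀ := by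
    intro X hX
    exact (hf.contMDiff_tangentMap le_rfl).contMDiffAt.comp y₀ hX
  -- (iv) the fields `∇_{df V} sᵢ` along `f`, via smooth Christoffel data
  obtain ⟨C, hC, hCs⟩ := exists_contMDiffOn_christoffel (cov := g.leviCivita)
    (g.isLocallyContMDiff_leviCivita_holds ⊤ (by exact_mod_cast le_top)) b x₁
  have hcov : ∀ i, ContMDiffAt I' I.tangent ∞ (fun y ↦ (TotalSpace.mk' E (f y)
      (g.leviCivita (e.localFrame b i) (f y) (mfderiv I' I f y (V y))) : TangentBundle I M)) y₀ := by
    intro i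
    have hsrc' : (TotalSpace.mk' E (f y₀) (g.leviCivita (e.localFrame b i) (f y₀)
        (mfderiv I' I f y₀ (V y₀))) : TangentBundle I M) ∈ e.source := by
      rw [e.mem_source, hbase]; exact h1₀
    refine (e.contMDiffAt_iff (f := fun y ↦ (TotalSpace.mk' E (f y)
      (g.leviCivita (e.localFrame b i) (f y) (mfderiv I' I f y (V y))) : TangentBundle I M))
      hsrc').2 ⟨hf y₀, ?_⟩
    -- the `e`-coordinate of `∇_{df V} sᵢ` is `Cᵢ (f y) (e-coordinate of df V)`
    have hdfV : ContMDiffAt I' 𝓘(ℝ, E) ∞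
        (fun y ↦ (e (TotalSpace.mk' E (f y) (mfderiv I' I f y (V y)) : TangentBundle I M)).2) y₀ := by
      have hsrc'' : (TotalSpace.mk' E (f y₀) (mfderiv I' I f y₀ (V y₀)) : TangentBundle I M) ∈
          e.source := by rw [e.mem_source, hbase]; exact h1₀
      exact ((e.contMDiffAt_iff (f := fun y ↦ (TotalSpace.mk' E (f y)
        (mfderiv I' I f y (V y)) : TangentBundle I M)) hsrc'').1 (htan hV)).2
    have hCf : ContMDiffAt I' 𝓘(ℝ, E →L[ℝ] E) ∞ (fun y ↦ C i (f y)) y₀ :=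
      ((hCs i).contMDiffAt ((chartAt H x₁).open_source.mem_nhds h1₀)).comp y₀ (hf y₀)
    refine (hCf.clm_apply hdfV).congr_of_eventuallyEq ?_
    filter_upwards [hnear] with y hy
    have hye : f y ∈ e.baseSet := by rwa [hbase]
    rw [← hC (f y) hy i (mfderiv I' I f y (V y)),
      Trivialization.continuousLinearMapAt_apply_of_mem ℝ _ hye]
  -- assemble
  refine (ContMDiffAt.sum fun i _ ↦ ?_).add (ContMDiffAt.sum fun i _ ↦ ?_)
  · exact (hVφ i).mul (contMDiffAt_val_apply_along g le_rfl (hsf i) (htan hW))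
  · exact (hφ i).mul (contMDiffAt_val_apply_along g le_rfl (hcov i) (htan hW))

/-- **The mean curvature of a smooth immersed hypersurface with smooth normal field is smooth.**
For a spacelike immersion `f : N → (M, g)` of class `C^∞` (`g` smooth, pullback-smoothness `hpb`)
and a field `ν` along `f` with `C^∞` lift to `TM`, the mean curvature `H = tr_{f^*g} K_ν` is a
`C^∞` function on `N`: near each point, in the frame `s'ₐ` of `TN`,
`H = ∑_{ac} (𝒢⁻¹)_{ca} K_ν(s'ₐ, s'_c)` (`trace_eq_sum_gram_inv`) with the inverse Gram matrix of
the induced metric smooth (`contMDiffOn_gram_localFrame_inv`) and the entries of `K_ν` smooth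
(`contMDiffAt_secondFundamentalForm_apply`). O'Neill 1983, Ch. 4, p. 111 ff. (the mean curvature
vector field is a smooth normal field); Wald 1984, (10.2.13) ff. This supplies the regularity
hypothesis `H ∈ C²(N_t)` of `IsClassicalIMCF.integral_meanCurvature_mul_dalembertian_inv_nonneg`
(`GerochMonotonicityProofs.lean`) for the leaves of a classical inverse mean curvature flow.
[cite: ONeill1983, Ch. 4, p. 111 ff] -/
theorem contMDiff_meanCurvature {f : N → M} (hpb : contMDiff_pullbackBilin I M I' N ∞)
    (hfi : g.IsSpacelikeImmersion I' f) (ν : NormalField I f)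
    (hν : ContMDiff I' I.tangent ∞ (fun x ↦ (TotalSpace.mk' E (f x) (ν x) : TangentBundle I M))) :
    CMDiff ∞ (fun y ↦ g.meanCurvature f hpb hfi ν y) := by
  classical
  have hf : ContMDiff I' I ∞ f := hfi.contMDiff_self
  intro y₀
  set e' := trivializationAt E' (TangentSpace I' : N → Type _) y₀ with he'
  set b' := Module.finBasis ℝ E' with hb'
  have hy₀ : y₀ ∈ e'.baseSet := FiberBundle.mem_baseSet_trivializationAt' y₀
  -- the mean curvature in the frame of `TN` at `y₀`, near `y₀`
  have hformula : (fun y ↦ g.meanCurvature f hpb hfi ν y) =ᶠ[𝓝 y₀] fun y ↦ ∑ a, ∑ c,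
      (Matrix.of fun a c ↦ (g.inducedMetric f hpb hfi).val y (e'.localFrame b' a y)
        (e'.localFrame b' c y))⁻¹ c a *
        g.secondFundamentalForm I' f ν y (e'.localFrame b' a y) (e'.localFrame b' c y) := by
    filter_upwards [e'.open_baseSet.mem_nhds hy₀] with y hy
    rw [meanCurvature, trace_eq_sum_gram_inv _ y (e'.basisAt b' hy)]
    simp only [← e'.localFrame_apply_of_mem_baseSet b' hy]
  refine ContMDiffAt.congr_of_eventuallyEq ?_ hformula
  refine ContMDiffAt.sum fun a _ ↦ ContMDiffAt.sum fun c _ ↦ ?_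
  exact ((contMDiffOn_gram_localFrame_inv e' (g.inducedMetric f hpb hfi) b' c a y₀ hy₀).contMDiffAt
    (e'.open_baseSet.mem_nhds hy₀)).mul
    (g.contMDiffAt_secondFundamentalForm_apply hf hν (contMDiffAt_localFrame_of_mem ∞ e' b' a hy₀)
      (contMDiffAt_localFrame_of_mem ∞ e' b' c hy₀))

end PseudoRiemannianMetric

end Literature.Geometry.Lorentzian

end
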